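import Summits.AtomisticToContinuum.HydrodynamicLimit.Theorems.LocalSecondLaw.Negative.EnergyFluctuation
import Summits.AtomisticToContinuum.HydrodynamicLimit.Theorems.LocalSecondLaw.Negative.ConeNormalisation

/-!
# `E_N[Dev] → 0` at equilibrium: the mollified conserved fields converge in `L¹`

Tightness programme, steps D1 and D, for the crux `JParityClosure.LocalSecondLaw` (stmt-AtomisticToContinuum-13081;
standing disprover's `Cruxes/LocalSecondLaw/Disproof.lean`).  D1: under the homogeneous unit local Gibbs laws with
the identified `t = 0` LLN, `E_N|ρ_r(x₀) - 1| → 0` for every field point (bounded convergence: `0 ≤ ρ_r ≤ C_r`,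
density LLN at the test function `b_r(·, x₀)`, whose mass is `1` by `integral_cone_eq_one'`).  D: with the linear
majorant, `E_N[dev(x₀)] ≤ (δ + c_N/δ) + 4 E_N|ρ_r(x₀) - 1|` (`lintegral_dev_le`), hence `E_N[dev(x₀)] → 0`
(`tendsto_lintegral_dev`); Tonelli over the field point (`lintegral_Dev_eq`, joint continuity of `dev`) and
dominated convergence on `𝕋³` with the constant bound `1 + c_0 + 4(C_r + 1)` (steps D1/D2 at `δ = 0, 1`) give
`E_N[Dev] → 0` (`tendsto_lintegral_Dev`).  No fourth moments or uniformity in `x₀` are needed.  refuter-cdisprove-stmt-AtomisticToContinuum-13081-0.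
-/

noncomputable section

namespace Summit.AtomisticToContinuum.HydrodynamicLimit.Theorems.LocalSecondLawNegative

open MeasureTheory Filter Set Topology
open scoped ENNReal
open Literature.MathematicalPhysics.KineticTheory Literature.Analysis.FluidPDE

variable {N : ℕ}

/-- `rhoC ≤ C_r`. [folklore] -/
theorem rhoC_le_const {r : ℝ} (hr : 0 < r) (w : Config (N + 1) (Fin 3) T3) (x₀ : T3) :
    rhoC r w x₀ ≤ 3 / (Real.pi * r ^ 3) := by
  unfold rhoC
  rw [integral_empiricalMeasure]
  calc ((N + 1 : ℕ) : ℝ)⁻¹ * ∑ i, cone r (w i).1 x₀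
      ≤ ((N + 1 : ℕ) : ℝ)⁻¹ * ∑ _i : Fin (N + 1), 3 / (Real.pi * r ^ 3) := by
        gcongr with i
        exact cone_le_const hr _ _
    _ = 3 / (Real.pi * r ^ 3) := by
        rw [Finset.sum_const, Finset.card_univ, Fintype.card_fin, nsmul_eq_mul]
        field_simp

/-- The mollified density is the empirical density field of the cone test function. [folklore] -/
theorem rhoC_eq_empiricalDensityField (r : ℝ) (w : Config (N + 1) (Fin 3) T3) (x₀ : T3) :
    rhoC r w x₀ = empiricalDensityField w (fun y => cone r y x₀) := rfl

/-- `∫ b_r(·, x₀) = 1` in the particle variable (symmetry of the minimal-image distance). [folklore] -/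
theorem integral_cone_eq_one' {r : ℝ} (hr : 0 < r) (hr2 : r < 1 / 2) (x₀ : T3) :
    ∫ y, cone r y x₀ = 1 := by
  have h := integral_cone_eq_one hr hr2 x₀
  unfold cone
  simp_rw [Torus.euclidDist_comm _ x₀]
  exact h

/-- A bounded-convergence estimate: `E|ρ_r(x₀) - 1| ≤ δ + (C_r + 1)·P(δ < |ρ_r(x₀) - 1|)`. [folklore] -/
theorem lintegral_rhoC_sub_one_le {σ r : ℝ} (hr : 0 < r) (hσ : σ ≤ 1 / 2) (N : ℕ)
    (Φ : HardSphereFlow (Torus.geometry (Fin 3)) (hsDiameter σ N) (N + 1)) (x₀ : T3) (δ : ℝ) :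
    ∫⁻ w, ENNReal.ofReal |rhoC r w x₀ - 1| ∂(localGibbsLaw σ (fun _ => 1) (fun _ => 0) (fun _ => 1) N Φ) ≤
      ENNReal.ofReal δ + ENNReal.ofReal (3 / (Real.pi * r ^ 3) + 1) *
        localGibbsLaw σ (fun _ => 1) (fun _ => 0) (fun _ => 1) N Φ {w | δ < |rhoC r w x₀ - 1|} := by
  set LG := localGibbsLaw σ (fun _ => 1) (fun _ => 0) (fun _ => 1) N Φ with hLG
  haveI : IsProbabilityMeasure LG :=
    isProbabilityMeasure_localGibbsLaw continuous_const continuous_const continuous_const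
      (fun _ => one_pos) (fun _ => one_pos) hσ N Φ
  have hρc : Continuous fun w : Config (N + 1) (Fin 3) T3 => rhoC r w x₀ := by
    have h := (continuous_rhoC_uncurry (N := N) r).comp (Continuous.prodMk_left x₀)
    simpa only [Function.comp_def] using h
  have hA : MeasurableSet {w : Config (N + 1) (Fin 3) T3 | δ < |rhoC r w x₀ - 1|} :=
    measurableSet_lt measurable_const (hρc.sub continuous_const).abs.measurable
  rw [← lintegral_add_compl _ hA, add_comm]
  refine add_le_add ?_ ?_
  · calc ∫⁻ w in {w | δ < |rhoC r w x₀ - 1|}ᶜ, ENNReal.ofReal |rhoC r w x₀ - 1| ∂LG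
        ≤ ∫⁻ _ in {w | δ < |rhoC r w x₀ - 1|}ᶜ, ENNReal.ofReal δ ∂LG :=
          setLIntegral_mono' hA.compl fun w hw => ENNReal.ofReal_le_ofReal (not_lt.1 hw)
      _ ≤ ENNReal.ofReal δ := by
          rw [setLIntegral_const]
          exact mul_le_of_le_one_right zero_le prob_le_one
  · calc ∫⁻ w in {w | δ < |rhoC r w x₀ - 1|}, ENNReal.ofReal |rhoC r w x₀ - 1| ∂LG
        ≤ ∫⁻ _ in {w | δ < |rhoC r w x₀ - 1|}, ENNReal.ofReal (3 / (Real.pi * r ^ 3) + 1) ∂LG := by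
          refine lintegral_mono fun w => ENNReal.ofReal_le_ofReal ?_
          have h1 := rhoC_le_const hr w x₀
          have h2 := rhoC_nonneg hr w x₀
          rw [abs_le]; constructor <;> linarith
      _ = ENNReal.ofReal (3 / (Real.pi * r ^ 3) + 1) * LG {w | δ < |rhoC r w x₀ - 1|} := by
          rw [setLIntegral_const]

/-- **`L¹` convergence of the mollified density at equilibrium**, pointwise in the field point: under the
homogeneous unit local Gibbs laws with the identified `t = 0` LLN, `E_N |ρ_r(x₀) - 1| → 0`. [folklore] -/
theorem tendsto_lintegral_rhoC_sub_one {σ r : ℝ} (hr : 0 < r) (hr2 : r < 1 / 2) (hσ : σ ≤ 1 / 2)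
    (Φ : (N : ℕ) → HardSphereFlow (Torus.geometry (Fin 3)) (hsDiameter σ N) (N + 1))
    (hT : TendstoHydroFieldsAt (fun N => localGibbsLaw σ (fun _ => 1) (fun _ => 0) (fun _ => 1) N (Φ N))
      Φ (fun _ _ => 1) (fun _ _ => 0) (fun _ _ => 1) 0) (x₀ : T3) :
    Tendsto (fun N => ∫⁻ w, ENNReal.ofReal |rhoC r w x₀ - 1|
      ∂(localGibbsLaw σ (fun _ => 1) (fun _ => 0) (fun _ => 1) N (Φ N))) atTop (𝓝 0) := by
  -- the LLN event, read at time 0 through the flow and a.e. back on the configuration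
  have hP : ∀ δ : ℝ, 0 < δ → Tendsto (fun N => localGibbsLaw σ (fun _ => 1) (fun _ => 0) (fun _ => 1)
      N (Φ N) {w | δ < |rhoC r w x₀ - 1|}) atTop (𝓝 0) := by
    intro δ hδ
    have h := (hT (fun y => cone r y x₀) (continuous_cone_comp r continuous_id continuous_const) δ hδ).1
    have hint : ∫ y : T3, cone r y x₀ * (fun (_ : ℝ) (_ : T3) => (1 : ℝ)) 0 y = 1 := by
      show ∫ y : T3, cone r y x₀ * 1 = 1
      simp_rw [mul_one]; exact integral_cone_eq_one' hr hr2 x₀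
    refine h.congr' (Eventually.of_forall fun N => measure_congr ?_)
    have hg : ∀ᵐ z ∂(localGibbsLaw σ (fun _ => 1) (fun _ => 0) (fun _ => 1) N (Φ N)), z ∈ (Φ N).good :=
      (withDensity_absolutelyContinuous (μ := liouville (Torus.geometry (Fin 3)) (N + 1)
        (hsDiameter σ N)) _).ae_le (Φ N).ae_mem_good
    filter_upwards [hg] with z hz
    simp only [eq_iff_iff]
    show z ∈ {z | δ < |empiricalDensityField ((Φ N).flow 0 z) (fun y => cone r y x₀) -
        ∫ y : T3, cone r y x₀ * (fun (_ : ℝ) (_ : T3) => (1 : ℝ)) 0 y|} ↔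
      z ∈ {w | δ < |rhoC r w x₀ - 1|}
    rw [Set.mem_setOf_eq, Set.mem_setOf_eq, (Φ N).flow_zero z hz, hint,
      ← rhoC_eq_empiricalDensityField]
  rw [ENNReal.tendsto_nhds_zero]
  intro ε hε
  by_cases hεtop : ε = ⊤
  · exact Eventually.of_forall fun N => hεtop ▸ le_top
  set δ : ℝ := ε.toReal / 2 with hδdef
  have hεr : 0 < ε.toReal := ENNReal.toReal_pos hε.ne' hεtop
  have hδ : 0 < δ := by positivity
  have hδε : ENNReal.ofReal δ ≤ ε / 2 := by
    rw [hδdef, ENNReal.ofReal_div_of_pos two_pos, ENNReal.ofReal_toReal hεtop]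
    norm_num
  have hC := (ENNReal.Tendsto.const_mul (hP δ hδ) (Or.inr ENNReal.ofReal_ne_top) :
    Tendsto (fun N => ENNReal.ofReal (3 / (Real.pi * r ^ 3) + 1) *
      localGibbsLaw σ (fun _ => 1) (fun _ => 0) (fun _ => 1) N (Φ N) {w | δ < |rhoC r w x₀ - 1|})
        atTop (𝓝 (ENNReal.ofReal (3 / (Real.pi * r ^ 3) + 1) * 0)))
  rw [mul_zero] at hC
  have hev := hC.eventually (gt_mem_nhds (show (0 : ℝ≥0∞) < ε / 2 from
    ENNReal.half_pos hε.ne'))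
  filter_upwards [hev] with N hN
  calc ∫⁻ w, ENNReal.ofReal |rhoC r w x₀ - 1| ∂(localGibbsLaw σ (fun _ => 1) (fun _ => 0) (fun _ => 1) N (Φ N))
      ≤ ENNReal.ofReal δ + ENNReal.ofReal (3 / (Real.pi * r ^ 3) + 1) *
          localGibbsLaw σ (fun _ => 1) (fun _ => 0) (fun _ => 1) N (Φ N) {w | δ < |rhoC r w x₀ - 1|} :=
        lintegral_rhoC_sub_one_le hr hσ N (Φ N) x₀ δ
    _ ≤ ε / 2 + ε / 2 := add_le_add hδε hN.le
    _ = ε := ENNReal.add_halves ε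


/-- `c_N ≤ c_0`. [folklore] -/
theorem fluctConst_le (r : ℝ) (N : ℕ) : fluctConst r N ≤ fluctConst r 0 := by
  unfold fluctConst
  have hA : 0 ≤ (3 / (Real.pi * r ^ 3)) ^ 2 * (1 / 2 * gaussFourthMomentConst (Fin 3)) := by
    have := gaussFourthMomentConst_nonneg (ι := Fin 3); positivity
  refine div_le_div_of_nonneg_left hA (by norm_num) ?_
  push_cast; linarith [(Nat.cast_nonneg N : (0 : ℝ) ≤ N)]

/-- `dev ≤ |e_r - (3/2)ρ_r| + 4|ρ_r - 1|`. [folklore] -/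
theorem dev_le_fluct (r : ℝ) (w : Config (N + 1) (Fin 3) T3) (x₀ : T3) :
    dev r w x₀ ≤ |kinC r w x₀ - 3 / 2 * rhoC r w x₀| + 4 * |rhoC r w x₀ - 1| := by
  unfold dev
  have h : kinC r w x₀ - 3 / 2 = (kinC r w x₀ - 3 / 2 * rhoC r w x₀) + 3 / 2 * (rhoC r w x₀ - 1) := by
    ring
  rw [h]
  have h1 := abs_add_le (kinC r w x₀ - 3 / 2 * rhoC r w x₀) (3 / 2 * (rhoC r w x₀ - 1))
  rw [abs_mul, abs_of_pos (by norm_num : (0 : ℝ) < 3 / 2)] at h1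
  linarith [abs_nonneg (rhoC r w x₀ - 1)]

/-- `E_N[dev(x₀)] ≤ (δ + c_N/δ) + 4 E_N|ρ_r(x₀) - 1|`. [folklore] -/
theorem lintegral_dev_le {σ r : ℝ} (hr : 0 < r) (hσ : σ ≤ 1 / 2) (N : ℕ)
    (Φ : HardSphereFlow (Torus.geometry (Fin 3)) (hsDiameter σ N) (N + 1)) (x₀ : T3)
    {δ : ℝ} (hδ : 0 < δ) :
    ∫⁻ w, ENNReal.ofReal (dev r w x₀) ∂(localGibbsLaw σ (fun _ => 1) (fun _ => 0) (fun _ => 1) N Φ) ≤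
      (ENNReal.ofReal δ + ENNReal.ofReal (fluctConst r N / δ)) +
        4 * ∫⁻ w, ENNReal.ofReal |rhoC r w x₀ - 1|
          ∂(localGibbsLaw σ (fun _ => 1) (fun _ => 0) (fun _ => 1) N Φ) := by
  set LG := localGibbsLaw σ (fun _ => 1) (fun _ => 0) (fun _ => 1) N Φ with hLG
  have hρc : Continuous fun w : Config (N + 1) (Fin 3) T3 => rhoC r w x₀ := by
    have h := (continuous_rhoC_uncurry (N := N) r).comp (Continuous.prodMk_left x₀)
    simpa only [Function.comp_def] using h
  have hmW : Measurable fun w : Config (N + 1) (Fin 3) T3 =>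
      ENNReal.ofReal |kinC r w x₀ - 3 / 2 * rhoC r w x₀| :=
    (continuous_fluct r x₀).measurable.ennreal_ofReal
  have hmX : Measurable fun w : Config (N + 1) (Fin 3) T3 => ENNReal.ofReal |rhoC r w x₀ - 1| :=
    (hρc.sub continuous_const).abs.measurable.ennreal_ofReal
  calc ∫⁻ w, ENNReal.ofReal (dev r w x₀) ∂LG
      ≤ ∫⁻ w, (ENNReal.ofReal |kinC r w x₀ - 3 / 2 * rhoC r w x₀| +
          4 * ENNReal.ofReal |rhoC r w x₀ - 1|) ∂LG := by
        refine lintegral_mono fun w => ?_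
        calc ENNReal.ofReal (dev r w x₀)
            ≤ ENNReal.ofReal (|kinC r w x₀ - 3 / 2 * rhoC r w x₀| + 4 * |rhoC r w x₀ - 1|) :=
              ENNReal.ofReal_le_ofReal (dev_le_fluct r w x₀)
          _ = ENNReal.ofReal |kinC r w x₀ - 3 / 2 * rhoC r w x₀| +
              4 * ENNReal.ofReal |rhoC r w x₀ - 1| := by
              rw [ENNReal.ofReal_add (abs_nonneg _) (by positivity), ENNReal.ofReal_mul (by norm_num),
                ENNReal.ofReal_ofNat]
    _ = (∫⁻ w, ENNReal.ofReal |kinC r w x₀ - 3 / 2 * rhoC r w x₀| ∂LG) +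
          4 * ∫⁻ w, ENNReal.ofReal |rhoC r w x₀ - 1| ∂LG := by
        rw [lintegral_add_left hmW, lintegral_const_mul _ hmX]
    _ ≤ (ENNReal.ofReal δ + ENNReal.ofReal (fluctConst r N / δ)) +
          4 * ∫⁻ w, ENNReal.ofReal |rhoC r w x₀ - 1| ∂LG := by
        gcongr
        exact lintegral_fluct_le hr hσ N Φ x₀ hδ

/-- **`E_N[dev(x₀)] → 0`** pointwise in the field point. [folklore] -/
theorem tendsto_lintegral_dev {σ r : ℝ} (hr : 0 < r) (hr2 : r < 1 / 2) (hσ : σ ≤ 1 / 2)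
    (Φ : (N : ℕ) → HardSphereFlow (Torus.geometry (Fin 3)) (hsDiameter σ N) (N + 1))
    (hT : TendstoHydroFieldsAt (fun N => localGibbsLaw σ (fun _ => 1) (fun _ => 0) (fun _ => 1) N (Φ N))
      Φ (fun _ _ => 1) (fun _ _ => 0) (fun _ _ => 1) 0) (x₀ : T3) :
    Tendsto (fun N => ∫⁻ w, ENNReal.ofReal (dev r w x₀)
      ∂(localGibbsLaw σ (fun _ => 1) (fun _ => 0) (fun _ => 1) N (Φ N))) atTop (𝓝 0) := by
  have hX := tendsto_lintegral_rhoC_sub_one hr hr2 hσ Φ hT x₀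
  rw [ENNReal.tendsto_nhds_zero]
  intro ε hε
  by_cases hεtop : ε = ⊤
  · exact Eventually.of_forall fun N => hεtop ▸ le_top
  set δ : ℝ := ε.toReal / 3 with hδdef
  have hεr : 0 < ε.toReal := ENNReal.toReal_pos hε.ne' hεtop
  have hδ : 0 < δ := by positivity
  have hδε : ENNReal.ofReal δ ≤ ε / 3 := by
    rw [hδdef, ENNReal.ofReal_div_of_pos (by norm_num), ENNReal.ofReal_toReal hεtop]
    norm_num
  have h3 : (0 : ℝ≥0∞) < ε / 3 := ENNReal.div_pos hε.ne' (by norm_num)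
  -- the fluctuation term
  have hc : Tendsto (fun N => ENNReal.ofReal (fluctConst r N / δ)) atTop (𝓝 0) := by
    have h := ENNReal.tendsto_ofReal ((tendsto_fluctConst r).div_const δ)
    rwa [zero_div, ENNReal.ofReal_zero] at h
  have hev1 := hc.eventually (gt_mem_nhds h3)
  -- the density term
  have hX4 : Tendsto (fun N => 4 * ∫⁻ w, ENNReal.ofReal |rhoC r w x₀ - 1|
      ∂(localGibbsLaw σ (fun _ => 1) (fun _ => 0) (fun _ => 1) N (Φ N))) atTop (𝓝 0) := by
    have h := ENNReal.Tendsto.const_mul hX (Or.inr (by norm_num : (4 : ℝ≥0∞) ≠ ⊤))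
    rwa [mul_zero] at h
  have hev2 := hX4.eventually (gt_mem_nhds h3)
  filter_upwards [hev1, hev2] with N h1 h2
  calc ∫⁻ w, ENNReal.ofReal (dev r w x₀) ∂(localGibbsLaw σ (fun _ => 1) (fun _ => 0) (fun _ => 1) N (Φ N))
      ≤ (ENNReal.ofReal δ + ENNReal.ofReal (fluctConst r N / δ)) +
          4 * ∫⁻ w, ENNReal.ofReal |rhoC r w x₀ - 1|
            ∂(localGibbsLaw σ (fun _ => 1) (fun _ => 0) (fun _ => 1) N (Φ N)) :=
        lintegral_dev_le hr hσ N (Φ N) x₀ hδ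
    _ ≤ (ε / 3 + ε / 3) + ε / 3 := add_le_add (add_le_add hδε h1.le) h2.le
    _ = ε := ENNReal.add_thirds ε

/-- Tonelli: `E_N[Dev] = ∫ E_N[dev(x₀)] dx₀`. [folklore] -/
theorem lintegral_Dev_eq {σ : ℝ} (hσ : σ ≤ 1 / 2) (r : ℝ) (N : ℕ)
    (Φ : HardSphereFlow (Torus.geometry (Fin 3)) (hsDiameter σ N) (N + 1)) :
    ∫⁻ w, ENNReal.ofReal (Dev r w) ∂(localGibbsLaw σ (fun _ => 1) (fun _ => 0) (fun _ => 1) N Φ) =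
      ∫⁻ x₀, ∫⁻ w, ENNReal.ofReal (dev r w x₀)
        ∂(localGibbsLaw σ (fun _ => 1) (fun _ => 0) (fun _ => 1) N Φ) := by
  haveI : IsProbabilityMeasure (localGibbsLaw σ (fun _ => 1) (fun _ => 0) (fun _ => 1) N Φ) :=
    isProbabilityMeasure_localGibbsLaw continuous_const continuous_const continuous_const
      (fun _ => one_pos) (fun _ => one_pos) hσ N Φ
  have h1 : ∀ w : Config (N + 1) (Fin 3) T3, ENNReal.ofReal (Dev r w) = ∫⁻ x₀, ENNReal.ofReal (dev r w x₀) := by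
    intro w
    unfold Dev
    exact ofReal_integral_eq_lintegral_ofReal (integrable_of_continuous_T3 (continuous_dev r w))
      (ae_of_all _ (dev_nonneg r w))
  simp_rw [h1]
  exact lintegral_lintegral_swap
    ((continuous_dev_uncurry r).measurable.ennreal_ofReal.aemeasurable)

/-- **`E_N[Dev] → 0`**: dominated convergence over the field point `x₀ ∈ 𝕋³` (domination by the
constant `1 + c_0 + 4(C_r + 1)` from steps D1/D2 at `δ = 1`, `δ = 0`). [folklore] -/
theorem tendsto_lintegral_Dev {σ r : ℝ} (hr : 0 < r) (hr2 : r < 1 / 2) (hσ : σ ≤ 1 / 2)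
    (Φ : (N : ℕ) → HardSphereFlow (Torus.geometry (Fin 3)) (hsDiameter σ N) (N + 1))
    (hT : TendstoHydroFieldsAt (fun N => localGibbsLaw σ (fun _ => 1) (fun _ => 0) (fun _ => 1) N (Φ N))
      Φ (fun _ _ => 1) (fun _ _ => 0) (fun _ _ => 1) 0) :
    Tendsto (fun N => ∫⁻ w, ENNReal.ofReal (Dev r w)
      ∂(localGibbsLaw σ (fun _ => 1) (fun _ => 0) (fun _ => 1) N (Φ N))) atTop (𝓝 0) := by
  simp_rw [lintegral_Dev_eq hσ]
  set Bd : ℝ≥0∞ := (ENNReal.ofReal 1 + ENNReal.ofReal (fluctConst r 0 / 1)) +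
    4 * (ENNReal.ofReal 0 + ENNReal.ofReal (3 / (Real.pi * r ^ 3) + 1) * 1) with hBd
  have hmeas : ∀ N, Measurable fun x₀ : T3 => ∫⁻ w, ENNReal.ofReal (dev r w x₀)
      ∂(localGibbsLaw σ (fun _ => 1) (fun _ => 0) (fun _ => 1) N (Φ N)) := fun N => by
    haveI : IsProbabilityMeasure (localGibbsLaw σ (fun _ => 1) (fun _ => 0) (fun _ => 1) N (Φ N)) :=
      isProbabilityMeasure_localGibbsLaw continuous_const continuous_const continuous_const
        (fun _ => one_pos) (fun _ => one_pos) hσ N (Φ N)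
    exact ((continuous_dev_uncurry (N := N) r).measurable.ennreal_ofReal).lintegral_prod_left'
  have hbound : ∀ N, ∀ᵐ x₀ : T3, ∫⁻ w, ENNReal.ofReal (dev r w x₀)
      ∂(localGibbsLaw σ (fun _ => 1) (fun _ => 0) (fun _ => 1) N (Φ N)) ≤ Bd := by
    intro N
    refine ae_of_all _ fun x₀ => ?_
    haveI : IsProbabilityMeasure (localGibbsLaw σ (fun _ => 1) (fun _ => 0) (fun _ => 1) N (Φ N)) :=
      isProbabilityMeasure_localGibbsLaw continuous_const continuous_const continuous_const
        (fun _ => one_pos) (fun _ => one_pos) hσ N (Φ N)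
    refine (lintegral_dev_le hr hσ N (Φ N) x₀ one_pos).trans ?_
    rw [hBd]
    gcongr
    · exact fluctConst_le r N
    · exact (lintegral_rhoC_sub_one_le hr hσ N (Φ N) x₀ 0).trans (by gcongr; exact prob_le_one)
  have hfin : ∫⁻ _ : T3, Bd ≠ ⊤ := by
    rw [lintegral_const, measure_univ, mul_one, hBd]
    simp [ENNReal.mul_eq_top, ENNReal.add_eq_top]
  have hlim : ∀ᵐ x₀ : T3, Tendsto (fun N => ∫⁻ w, ENNReal.ofReal (dev r w x₀)
      ∂(localGibbsLaw σ (fun _ => 1) (fun _ => 0) (fun _ => 1) N (Φ N))) atTop (𝓝 0) :=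
    ae_of_all _ fun x₀ => tendsto_lintegral_dev hr hr2 hσ Φ hT x₀
  have h := tendsto_lintegral_of_dominated_convergence (fun _ => Bd) hmeas hbound hfin hlim
  simpa using h


end Summit.AtomisticToContinuum.HydrodynamicLimit.Theorems.LocalSecondLawNegative

end
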